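import Literature.Barriers.QuantumFields.JostSchroerShellGeometry
import HarnessLib

/-!
# The Jost–Schroer theorem (Streater–Wightman Thm 4-15): smooth cut-offs localising to one sheet
of the mass hyperboloid

Sibling of `JostSchroerShellGeometry.lean` (barrier catalogue D-0021, summit `QuantumFields`), in
the decomposition of S–W (4-80) (`JostSchroerVacuumProduct`) and of `[φ₋(x), φ₋(y)]Ψ₀ = 0`
(`JostSchroerNegFreqCommutator`). In the printed proof (held 2000 printing, pdf pp. 147–148) the
spectrum of `φ̃±` lies on the upper, resp. lower sheet of `p² = m²`; in the smeared rendering this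
is used through Fourier multipliers whose symbols are `1` near one sheet and supported in the
uniform neighbourhood `{|kgSymbol| < c}` of the hyperboloid on the corresponding side. This file
defines these two symbols and proves their properties:

* `upperCutoff d m c ξ = b(kgSymbol ξ / c) · σ(ξ⁰)` and `lowerCutoff d m c ξ = b(kgSymbol ξ / c) ·
  (1 − σ(ξ⁰))`, with `b` the plateau bump of `JostSchroerShellDivision` (`= 1` on `[−3/4, 3/4]`,
  `= 0` off `(−1, 1)`) and `σ = freqStep (m/2)` the smooth step in the energy (`0` below `−m/4π`,
  `1` above `m/4π`); both have temperate growth (`hasTemperateGrowth_upperCutoff`, `…lowerCutoff`);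
* `upperCutoff = 1` where `|kgSymbol| ≤ 3c/4` and `ξ⁰ ≥ m/4π`, `= 0` where `|kgSymbol| ≥ c`; where it
  is non-zero, `|kgSymbol| < c` and (for `c ≤ 3m²/4`) `ξ⁰ > m/4π` (`upperCutoff_ne_zero`), and
  symmetrically for `lowerCutoff`;
* the support of `lowerCutoff` lies in the closed backward cone (`neg_mem_closedForwardCone_of_lowerCutoff_ne_zero`,
  `c ≤ 3m²/4`): near the lower sheet the momenta are backward time-like — "the variables
  conjugate to `x` and `y` lie in the backward light cone".

## References

* R. F. Streater, A. S. Wightman, *PCT, Spin and Statistics, and All That*, §4-5, proof of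
  Thm 4-15 (pdf pp. 147–148). [StreaterWightman2001]
-/

noncomputable section

open Real Set

namespace Literature.Barriers.QuantumFields

open Literature.MathematicalPhysics.QuantumLattice

variable {d : ℕ}

section Cutoffs

variable (d)

/-- **The upper-sheet cut-off** `b(kgSymbol ξ / c) σ(ξ⁰)`: `1` near the upper mass shell, supported
in the upper part of `{|kgSymbol| < c}`. [cite: StreaterWightman2001, §4-5 proof of Thm 4-15] -/
def upperCutoff (m c : ℝ) (ξ : SpaceTime d) : ℝ :=
  (unitBump : ℝ → ℝ) (kgSymbol d m ξ / c) * freqStep (m / 2) (ξ 0)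

/-- **The lower-sheet cut-off** `b(kgSymbol ξ / c) (1 − σ(ξ⁰))`: `1` near the lower mass shell,
supported in the lower part of `{|kgSymbol| < c}`. [cite: StreaterWightman2001, §4-5 proof of Thm 4-15] -/
def lowerCutoff (m c : ℝ) (ξ : SpaceTime d) : ℝ :=
  (unitBump : ℝ → ℝ) (kgSymbol d m ξ / c) * (1 - freqStep (m / 2) (ξ 0))

variable {d}

/-- The bump factor has temperate growth. [folklore] -/
theorem hasTemperateGrowth_unitBump_kgSymbol (m c : ℝ) :
    (fun ξ : SpaceTime d => (unitBump : ℝ → ℝ) (kgSymbol d m ξ / c)).HasTemperateGrowth := by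
  have h1 : (fun ξ : SpaceTime d => kgSymbol d m ξ / c).HasTemperateGrowth := by
    simp_rw [div_eq_mul_inv]
    exact (hasTemperateGrowth_kgSymbol m).mul (Function.HasTemperateGrowth.const _)
  exact (unitBump.hasCompactSupport.hasTemperateGrowth unitBump.contDiff).comp h1

/-- The energy step has temperate growth on space-time (`m > 0`). [folklore] -/
theorem hasTemperateGrowth_freqStep_time {m : ℝ} (hm : 0 < m) :
    (fun ξ : SpaceTime d => freqStep (m / 2) (ξ 0)).HasTemperateGrowth :=
  (hasTemperateGrowth_freqStep (half_pos hm)).comp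
    (EuclideanSpace.proj (0 : Fin (d + 1)) : SpaceTime d →L[ℝ] ℝ).hasTemperateGrowth

/-- `upperCutoff` has temperate growth (`m > 0`). [folklore] -/
theorem hasTemperateGrowth_upperCutoff {m : ℝ} (hm : 0 < m) (c : ℝ) :
    (upperCutoff d m c).HasTemperateGrowth :=
  (hasTemperateGrowth_unitBump_kgSymbol m c).mul (hasTemperateGrowth_freqStep_time hm)

/-- `lowerCutoff` has temperate growth (`m > 0`). [folklore] -/
theorem hasTemperateGrowth_lowerCutoff {m : ℝ} (hm : 0 < m) (c : ℝ) :
    (lowerCutoff d m c).HasTemperateGrowth :=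
  (hasTemperateGrowth_unitBump_kgSymbol m c).mul
    ((Function.HasTemperateGrowth.const _).sub (hasTemperateGrowth_freqStep_time hm))

/-- The complexified cut-offs have temperate growth. [folklore] -/
theorem hasTemperateGrowth_upperCutoff_complex {m : ℝ} (hm : 0 < m) (c : ℝ) :
    (fun ξ : SpaceTime d => (upperCutoff d m c ξ : ℂ)).HasTemperateGrowth :=
  Function.Complex.hasTemperateGrowth_ofReal.comp (hasTemperateGrowth_upperCutoff hm c)

/-- The complexified cut-offs have temperate growth. [folklore] -/
theorem hasTemperateGrowth_lowerCutoff_complex {m : ℝ} (hm : 0 < m) (c : ℝ) :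
    (fun ξ : SpaceTime d => (lowerCutoff d m c ξ : ℂ)).HasTemperateGrowth :=
  Function.Complex.hasTemperateGrowth_ofReal.comp (hasTemperateGrowth_lowerCutoff hm c)

/-- `m/2/(2π) = m/4π`. [folklore] -/
theorem half_div_two_pi (m : ℝ) : m / 2 / (2 * π) = m / (4 * π) := by
  rw [div_div]; ring

/-- **`upperCutoff = 1` near the upper sheet**: where `|kgSymbol ξ| ≤ 3c/4` (`c > 0`) and
`ξ⁰ ≥ m/4π` (`m > 0`). [folklore] -/
theorem upperCutoff_eq_one {m c : ℝ} (hm : 0 < m) (hc : 0 < c) {ξ : SpaceTime d}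
    (hξ : |kgSymbol d m ξ| ≤ 3 * c / 4) (h0 : m / (4 * π) ≤ ξ 0) : upperCutoff d m c ξ = 1 := by
  rw [upperCutoff, unitBump_eq_one, freqStep_eq_one (half_pos hm) (by rwa [half_div_two_pi]),
    mul_one]
  rw [abs_div, abs_of_pos hc, div_le_iff₀ hc]
  linarith

/-- **`lowerCutoff = 1` near the lower sheet**: where `|kgSymbol ξ| ≤ 3c/4` and `ξ⁰ ≤ −m/4π`. [folklore] -/
theorem lowerCutoff_eq_one {m c : ℝ} (hm : 0 < m) (hc : 0 < c) {ξ : SpaceTime d}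
    (hξ : |kgSymbol d m ξ| ≤ 3 * c / 4) (h0 : ξ 0 ≤ -(m / (4 * π))) : lowerCutoff d m c ξ = 1 := by
  rw [lowerCutoff, unitBump_eq_one, freqStep_eq_zero (half_pos hm) (by rwa [half_div_two_pi]),
    sub_zero, mul_one]
  rw [abs_div, abs_of_pos hc, div_le_iff₀ hc]
  linarith

/-- The cut-offs vanish off `{|kgSymbol| < c}`. [folklore] -/
theorem upperCutoff_eq_zero_of_le {m c : ℝ} (hc : 0 < c) {ξ : SpaceTime d}
    (hξ : c ≤ |kgSymbol d m ξ|) : upperCutoff d m c ξ = 0 := by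
  rw [upperCutoff, unitBump_eq_zero, zero_mul]
  rwa [abs_div, abs_of_pos hc, le_div_iff₀ hc, one_mul]

/-- The cut-offs vanish off `{|kgSymbol| < c}`. [folklore] -/
theorem lowerCutoff_eq_zero_of_le {m c : ℝ} (hc : 0 < c) {ξ : SpaceTime d}
    (hξ : c ≤ |kgSymbol d m ξ|) : lowerCutoff d m c ξ = 0 := by
  rw [lowerCutoff, unitBump_eq_zero, zero_mul]
  rwa [abs_div, abs_of_pos hc, le_div_iff₀ hc, one_mul]

/-- `upperCutoff` vanishes for `ξ⁰ ≤ −m/4π`. [folklore] -/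
theorem upperCutoff_eq_zero_of_time_le {m c : ℝ} (hm : 0 < m) {ξ : SpaceTime d}
    (h0 : ξ 0 ≤ -(m / (4 * π))) : upperCutoff d m c ξ = 0 := by
  rw [upperCutoff, freqStep_eq_zero (half_pos hm) (by rwa [half_div_two_pi]), mul_zero]

/-- `lowerCutoff` vanishes for `ξ⁰ ≥ m/4π`. [folklore] -/
theorem lowerCutoff_eq_zero_of_le_time {m c : ℝ} (hm : 0 < m) {ξ : SpaceTime d}
    (h0 : m / (4 * π) ≤ ξ 0) : lowerCutoff d m c ξ = 0 := by
  rw [lowerCutoff, freqStep_eq_one (half_pos hm) (by rwa [half_div_two_pi]), sub_self, mul_zero]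

/-- **Support of `upperCutoff`**: where it is non-zero, `|kgSymbol ξ| < c` and `ξ⁰ > −m/4π`; for
`c ≤ 3m²/4` therefore `ξ⁰ > m/4π` (`time_gt_of_abs_kgSymbol_lt`). [folklore] -/
theorem upperCutoff_ne_zero {m c : ℝ} (hm : 0 < m) (hc : 0 < c) {ξ : SpaceTime d}
    (h : upperCutoff d m c ξ ≠ 0) : |kgSymbol d m ξ| < c ∧ -(m / (4 * π)) < ξ 0 := by
  constructor
  · by_contra hge
    exact h (upperCutoff_eq_zero_of_le hc (not_lt.1 hge))
  · by_contra hge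
    exact h (upperCutoff_eq_zero_of_time_le hm (not_lt.1 hge))

/-- **Support of `lowerCutoff`**: where it is non-zero, `|kgSymbol ξ| < c` and `ξ⁰ < m/4π`; for
`c ≤ 3m²/4` therefore `ξ⁰ < −m/4π` (`time_lt_of_abs_kgSymbol_lt`). [folklore] -/
theorem lowerCutoff_ne_zero {m c : ℝ} (hm : 0 < m) (hc : 0 < c) {ξ : SpaceTime d}
    (h : lowerCutoff d m c ξ ≠ 0) : |kgSymbol d m ξ| < c ∧ ξ 0 < m / (4 * π) := by
  constructor
  · by_contra hge
    exact h (lowerCutoff_eq_zero_of_le hc (not_lt.1 hge))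
  · by_contra hge
    exact h (lowerCutoff_eq_zero_of_le_time hm (not_lt.1 hge))

/-- Where `upperCutoff ≠ 0` and `c ≤ 3m²/4`: `ξ⁰ > m/4π`. [folklore] -/
theorem time_gt_of_upperCutoff_ne_zero {m c : ℝ} (hm : 0 < m) (hc : 0 < c) (hc' : c ≤ 3 * m ^ 2 / 4)
    {ξ : SpaceTime d} (h : upperCutoff d m c ξ ≠ 0) : m / (4 * π) < ξ 0 :=
  have h' := upperCutoff_ne_zero hm hc h
  time_gt_of_abs_kgSymbol_lt hm hc' h'.1 h'.2

/-- Where `lowerCutoff ≠ 0` and `c ≤ 3m²/4`: `ξ⁰ < −m/4π`. [folklore] -/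
theorem time_lt_of_lowerCutoff_ne_zero {m c : ℝ} (hm : 0 < m) (hc : 0 < c) (hc' : c ≤ 3 * m ^ 2 / 4)
    {ξ : SpaceTime d} (h : lowerCutoff d m c ξ ≠ 0) : ξ 0 < -(m / (4 * π)) :=
  have h' := lowerCutoff_ne_zero hm hc h
  time_lt_of_abs_kgSymbol_lt hm hc' h'.1 h'.2

/-- On `{|kgSymbol| < c}`, `c ≤ 3m²/4`, the momentum is time-like: `‖ξ⃗‖ < |ξ⁰|`. [folklore] -/
theorem norm_spaceC_lt_abs_time_of_abs_kgSymbol_lt {m c : ℝ}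
    (hc' : c ≤ 3 * m ^ 2 / 4) {ξ : SpaceTime d} (hξ : |kgSymbol d m ξ| < c) :
    ‖spaceC d ξ‖ < |ξ 0| := by
  rw [kgSymbol, minkowskiForm_self] at hξ
  have h1 : m ^ 2 - 4 * π ^ 2 * (ξ 0 ^ 2 - ‖spaceC d ξ‖ ^ 2) < c := (abs_lt.1 hξ).2
  have h2 : 0 < ξ 0 ^ 2 - ‖spaceC d ξ‖ ^ 2 := by nlinarith [pi_pos, sq_nonneg m]
  have h3 : ‖spaceC d ξ‖ ^ 2 < |ξ 0| ^ 2 := by rw [sq_abs]; linarith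
  exact lt_of_pow_lt_pow_left₀ 2 (abs_nonneg _) h3

/-- **"The variables conjugate to `x` and `y` lie in the backward light cone"**: where
`lowerCutoff ≠ 0` (`c ≤ 3m²/4`), `−ξ` lies in the closed forward cone.
[cite: StreaterWightman2001, §4-5 proof of Thm 4-15, before (4-83)] -/
theorem neg_mem_closedForwardCone_of_lowerCutoff_ne_zero {m c : ℝ} (hm : 0 < m) (hc : 0 < c)
    (hc' : c ≤ 3 * m ^ 2 / 4) {ξ : SpaceTime d} (h : lowerCutoff d m c ξ ≠ 0) :
    -ξ ∈ closedForwardCone d := by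
  have h1 := lowerCutoff_ne_zero hm hc h
  have h2 := time_lt_of_lowerCutoff_ne_zero hm hc hc' h
  have h3 := norm_spaceC_lt_abs_time_of_abs_kgSymbol_lt hc' h1.1
  have hμ : 0 < m / (4 * π) := by positivity
  rw [mem_closedForwardCone_iff, map_neg, norm_neg, PiLp.neg_apply]
  rw [abs_of_neg (by linarith)] at h3
  exact h3.le

/-- Symmetrically: where `upperCutoff ≠ 0` (`c ≤ 3m²/4`), `ξ` lies in the closed forward cone. [folklore] -/
theorem mem_closedForwardCone_of_upperCutoff_ne_zero {m c : ℝ} (hm : 0 < m) (hc : 0 < c)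
    (hc' : c ≤ 3 * m ^ 2 / 4) {ξ : SpaceTime d} (h : upperCutoff d m c ξ ≠ 0) :
    ξ ∈ closedForwardCone d := by
  have h1 := upperCutoff_ne_zero hm hc h
  have h2 := time_gt_of_upperCutoff_ne_zero hm hc hc' h
  have h3 := norm_spaceC_lt_abs_time_of_abs_kgSymbol_lt hc' h1.1
  have hμ : 0 < m / (4 * π) := by positivity
  rw [mem_closedForwardCone_iff]
  rw [abs_of_pos (by linarith)] at h3
  exact h3.le

/-- The support of `lowerCutoff` lies in the closed backward cone (`c ≤ 3m²/4`). [folklore] -/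
theorem tsupport_lowerCutoff_subset {m c : ℝ} (hm : 0 < m) (hc : 0 < c) (hc' : c ≤ 3 * m ^ 2 / 4) :
    tsupport (lowerCutoff d m c) ⊆ {ξ : SpaceTime d | -ξ ∈ closedForwardCone d} := by
  refine closure_minimal (fun ξ hξ => ?_) ?_
  · exact neg_mem_closedForwardCone_of_lowerCutoff_ne_zero hm hc hc' hξ
  · exact (isClosed_closedForwardCone (d := d)).preimage continuous_neg

end Cutoffs

end Literature.Barriers.QuantumFields
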